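import Summits.AtomisticToContinuum.Crystallization.Theorems.PalmUnimodularRigidityLayeredLawsSelectHcpDefs

/-!
# Route `PalmUnimodularRigidity`, crux `LayeredLawsSelectHcp` (stmt-AtomisticToContinuum-9226):
# definitions of the SELECTION half of line `mtp-prestress-split-ergodic-frame` (addendum to `…Defs`)

The registered stub `stub_haggSelection` of the checked skeleton
`Cruxes/LayeredLawsSelectHcp/Lines/mtp_prestress_split_ergodic_frame.lean` ("a minimising point-stationary
layered law is a.s. hcp-charted") splits into an ENERGETIC front end (`P(root is a cubic site) = 0`, which
needs the certified sign and domination of the Lennard-Jones interlayer couplings, route item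
stmt-AtomisticToContinuum-3063) and a POTENTIAL-FREE back end ("root a.s. not cubic ⇒ a.s. hcp-charted":
Palm transfer + the combinatorics of the contact graph of an ideal Barlow stacking). This file is the
vocabulary of that split, verbatim-adapted from §1 of the sibling skeleton
`Cruxes/LayeredLawsSelectHcp/Lines/stress_jump_young_hagg_density.lean` (where the back end is the registered
stub `stub_nullCubicRootGivesHcpWord`):

* `pts μ` — the atoms of a configuration measure (`pts (count|S) = S`);
* `Bond S x y` — the bond relation of a configuration (`x, y ∈ S`, `0 < dist x y ≤ 28/25`, the window of
  the crux's H4 bond-isomorphism); `IsHexSite S x` / `IsCubicSite S x` — the INTRINSIC (chart-free,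
  translation-covariant) hexagonal / cubic site predicates read off the bond graph; `cubicRoot` — the event
  "the root `0` is a cubic site of `pts μ`" (its probability is the stacking-fault density);
* a finite integer model of the first coordination shell of a site of an ideal Barlow stacking
  (`relLabel`, `ShellAdj`, `shellOffsets`: the twelve neighbour offsets of
  `Literature…BarlowCoordination.dist_barlowPos_eq_iff` — six in-layer, `threeOffsets` above and below —
  and their contact relation, the integer form of `BarlowCoordination.dist_barlowPos_eq_iff_form`), on
  which "the site is hexagonal iff the Hägg letters at its layer satisfy `s k = −s (k−1)`" is a decidable
  finite check.

All definitions are route-internal bookkeeping (`[folklore]`); nothing here closes an item; the one theorem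
(`bond_symm`) is the registered anchor of this addendum.
-/

noncomputable section

namespace Summit.AtomisticToContinuum.Crystallization.Theorems.PalmUnimodularRigidity.LayeredLawsSelectHcp

open MeasureTheory Set

/-- Euclidean `3`-space. [folklore] -/
local notation "E3" => EuclideanSpace ℝ (Fin 3)

/-! ## Atoms, bonds, hexagonal and cubic sites -/

/-- The atoms of a configuration measure: the points of positive mass (`pts (count|S) = S`). [folklore] -/
def pts (μ : Measure E3) : Set E3 := {y | μ {y} ≠ 0}

/-- The BOND relation of a configuration `S`: two points of `S` at distance in `(0, 28/25]` (the window
of the crux's H4 bond-isomorphism; in a Barlow-like configuration these are exactly the images of the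
touching pairs of the ideal stacking). Symmetric, irreflexive, translation-covariant. [folklore] -/
def Bond (S : Set E3) (x y : E3) : Prop :=
  x ∈ S ∧ y ∈ S ∧ 0 < dist x y ∧ dist x y ≤ 28 / 25

/-- `x` is a HEXAGONAL (hcp-like, anticuboctahedral) site of `S`: some bonded pair `p ~ q` of neighbours
of `x` has TWO distinct common neighbours `t, b` that are also neighbours of `x` (two shell triangles
sharing the shell edge `pq` — the signature of the triangular orthobicupola; in the cuboctahedron every
edge lies in exactly one triangle). In an ideal Barlow stacking the site `barlowPos s k i j` is hexagonal
iff `s k = -s (k-1)` (the upper and lower neighbour triples of `BarlowCoordination.dist_barlowPos_eq_iff`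
cover the same three hollows of the layer). [folklore] -/
def IsHexSite (S : Set E3) (x : E3) : Prop :=
  ∃ p q t b : E3, t ≠ b ∧ Bond S x p ∧ Bond S x q ∧ Bond S x t ∧ Bond S x b ∧ Bond S p q ∧
    Bond S t p ∧ Bond S t q ∧ Bond S b p ∧ Bond S b q

/-- `x` is a CUBIC (fcc-like, cuboctahedral) site of `S` — a stacking fault passes through `x` (Hägg
letters `s k = s (k-1)` at its layer): a point of `S` that is not hexagonal. [folklore] -/
def IsCubicSite (S : Set E3) (x : E3) : Prop :=
  x ∈ S ∧ ¬ IsHexSite S x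

/-- The event "the ROOT is a cubic site" (its probability under a point-stationary layered law is the
stacking-fault density). [folklore] -/
def cubicRoot : Set (Measure E3) := {μ | IsCubicSite (pts μ) 0}

/-! ## The finite model of the first coordination shell of an ideal Barlow stacking

Fix a site `x = barlowPos 1 √(2/3) s k i j` of the ideal stacking of a Hägg word `s` and write
`σ₁ = s (k-1)`, `σ₂ = s k` for the two letters adjacent to its layer. A site
`barlowPos 1 √(2/3) s (k + dk) (i + di) (j + dj)` of the layers `k-1, k, k+1` is coded by its OFFSET
`(dk, di, dj) ∈ {-1, 0, 1} × ℤ × ℤ`; its layer label relative to layer `k` is `relLabel σ₁ σ₂ dk`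
(`haggLabel s (k+1) - haggLabel s k = s k`, `haggLabel s (k-1) - haggLabel s k = -s (k-1)`), and two such
sites touch (`dist = 1`) iff `ShellAdj σ₁ σ₂` holds between their offsets (the integer form
`3(2P + Q + Λ)² + (3Q + Λ)² + 8K² = 12` of `BarlowCoordination.dist_barlowPos_eq_iff_form`). The twelve
neighbours of `x` are the offsets `shellOffsets σ₁ σ₂` (`BarlowCoordination.dist_barlowPos_eq_iff`:
`sixOffsets` in the layer, `threeOffsets` above and below, written out as offsets `(k'-k, i'-i, j'-j)`). -/

/-- Layer label of layer `k + dk` relative to layer `k`, for `dk ∈ {-1, 0, 1}`, in terms of the letters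
`σ₁ = s (k-1)`, `σ₂ = s k`: `0 ↦ 0`, `1 ↦ σ₂`, `-1 ↦ -σ₁`. [folklore] -/
def relLabel (σ₁ σ₂ dk : ℤ) : ℤ :=
  if dk = 1 then σ₂ else if dk = -1 then -σ₁ else 0

/-- Contact relation of the finite shell model: the sites with offsets `o = (dk, di, dj)` and
`o' = (dk', di', dj')` from `x` touch iff
`3(2(di - di') + (dj - dj') + Λ)² + (3(dj - dj') + Λ)² + 8(dk - dk')² = 12`,
`Λ = relLabel σ₁ σ₂ dk - relLabel σ₁ σ₂ dk'` (`dist_barlowPos_eq_iff_form` at `a = 1`, `h² = 2/3`).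
[folklore] -/
def ShellAdj (σ₁ σ₂ : ℤ) (o o' : ℤ × ℤ × ℤ) : Prop :=
  3 * (2 * (o.2.1 - o'.2.1) + (o.2.2 - o'.2.2) + (relLabel σ₁ σ₂ o.1 - relLabel σ₁ σ₂ o'.1)) ^ 2 +
      (3 * (o.2.2 - o'.2.2) + (relLabel σ₁ σ₂ o.1 - relLabel σ₁ σ₂ o'.1)) ^ 2 +
      8 * (o.1 - o'.1) ^ 2 = 12

/-- The contact relation of the shell model is decidable (an integer equation). -/
instance decidableShellAdj (σ₁ σ₂ : ℤ) (o o' : ℤ × ℤ × ℤ) : Decidable (ShellAdj σ₁ σ₂ o o') := by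
  unfold ShellAdj; infer_instance

/-- The twelve neighbour offsets `(k'-k, i'-i, j'-j)` of a site of layer `k` with adjacent letters
`σ₁ = s (k-1)`, `σ₂ = s k`: six in the layer (`-sixOffsets = sixOffsets`), three above
(`-threeOffsets (-σ₂) = threeOffsets σ₂`), three below (`-threeOffsets σ₁ = threeOffsets (-σ₁)`), cf.
`BarlowCoordination.dist_barlowPos_eq_iff`. For the hcp root (`σ₁ = -1`, `σ₂ = 1`) this is the list
of `hcpStarIdx`. [folklore] -/
def shellOffsets (σ₁ σ₂ : ℤ) : List (ℤ × ℤ × ℤ) :=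
  [(0, 1, 0), (0, -1, 0), (0, 0, 1), (0, 0, -1), (0, 1, -1), (0, -1, 1)] ++
    (if σ₂ = 1 then [(1, 0, 0), (1, -1, 0), (1, 0, -1)] else [(1, 0, 0), (1, 1, 0), (1, 0, 1)]) ++
    (if σ₁ = 1 then [(-1, 0, 0), (-1, 1, 0), (-1, 0, 1)] else [(-1, 0, 0), (-1, -1, 0), (-1, 0, -1)])

/-! ## Elementary read-backs -/

/-- Anchor (registered sub-goal of stmt-AtomisticToContinuum-9226; a Defs module must prove one registered
statement by name): bonds are symmetric. [folklore] -/
theorem bond_symm : ∀ (S : Set E3) (x y : E3), Bond S x y → Bond S y x :=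
  fun _ _ _ ⟨hx, hy, h0, h1⟩ => ⟨hy, hx, by rwa [dist_comm], by rwa [dist_comm]⟩

/-- The shell model of the hcp root lists exactly the twelve labels `hcpStarIdx` of the Defs module.
[folklore] -/
theorem mem_shellOffsets_hcp_iff (v : ℤ × ℤ × ℤ) : v ∈ shellOffsets (-1) 1 ↔ v ∈ hcpStarIdx := by
  simp only [shellOffsets, hcpStarIdx, Finset.mem_insert, Finset.mem_singleton, List.mem_append,
    List.mem_cons, List.not_mem_nil, if_true, show (-1 : ℤ) ≠ 1 by decide, if_false]
  tauto

end Summit.AtomisticToContinuum.Crystallization.Theorems.PalmUnimodularRigidity.LayeredLawsSelectHcp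

end
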